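import Summits.CriticalPhenomena.Ising3DConformalLimit.Theorems.EnergyNotSigmaSquaredMoebiusLimitExistsLocallyBounded
import Literature.Probability.LatticeModels.PointwiseScalingLimitEtaExists
import HarnessLib

/-!
# The pinned zoom is bounded for free at integer configurations along the integer meshes
(line `Sketch` of the crux `ExistsScaleCovariantLimit`, item stmt-CriticalPhenomena-1981;
stub `stub_intConfigBounded`, glue IB)

With the PINNED renormalisation `ρ_pin(δ) = ⟨σ₀σ_{⌊1/δ⌋e₀}⟩_{β_c}^{-1/2}` (`rhoPin`), the pinned zoom of the
critical `ℤ³` Ising correlators is `F_n(δ)(x) = ρ_pin(δ)ⁿ ⟨∏ σ_{[xᵢ/δ]}⟩_{β_c}`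
(`rescaledCorrelator (criticalCorr 3) rhoPin n δ x`). At a non-coincident configuration `y` with INTEGER
coordinates `zᵢ ∈ ℤ³` and along the integer meshes `δ = 1/m`, `m ≥ 1`, the lattice approximation is EXACT,
`[yᵢ/(1/m)] = m zᵢ` (`latticeApprox_one_div_natCast_of_int`), and `|F_n(1/m)(y)| ≤ (n)!` for all `m ≥ 1`,
with NO input on the two-point law:
* odd `n`: the critical odd correlators vanish (`criticalCorr_eq_zero_of_odd`);
* `n = 2p`: `0 ≤ ⟨∏σ⟩_{β_c}` (Griffiths I, the tree's `criticalCorr_nonneg'`) and NEWMAN'S GAUSSIAN INEQUALITY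
  for the critical state (`criticalCorr_le_pairingSum`, the infinite-volume form of the tree's
  `aizenman_nPoint_le_pairingSum_finite_holds`): `⟨∏σ_{m zᵢ}⟩ ≤ 𝒢_p[⟨σσ⟩](m z)`. Multiplying by
  `ρ_pin^{2p} = (ρ_pin²)^p ≥ 0` and reading the pairing functional at the level of INDICES
  (`PairIsing.pairingSum_eq_pow_mul`), `F_{2p}(1/m)(y)` is dominated by the pairing functional of the
  kernel `(i, j) ↦ ρ_pin(1/m)² ⟨σ_{m zᵢ}σ_{m zⱼ}⟩_{β_c}` (`i ≠ j`), whose entries are the pinned PAIR zooms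
  `F₂(1/m)(yᵢ, yⱼ) = ⟨σ₀σ_{m(zⱼ − zᵢ)}⟩ / ⟨σ₀σ_{m e₀}⟩` (`rescaledCorrelator_rhoPin_two`);
* THE FREE PAIR BOUND (`rescaledCorrelator_two_le_one_of_int`): for `zᵢ ≠ zⱼ`, `‖m(zⱼ − zᵢ)‖_∞ ≥ m ≥ 1`
  (`le_supNorm_natCast_smul`), so by the Messager–Miracle-Solé sphere sandwich
  (`criticalTwoPoint_axis_sandwich`: `⟨σ₀σ_w⟩ ≤ ⟨σ₀σ_{‖w‖_∞ e₀}⟩`) and axis monotonicity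
  (`criticalTwoPoint_axis_antitone`), `⟨σ₀σ_{m(zⱼ − zᵢ)}⟩ ≤ ⟨σ₀σ_{m e₀}⟩`, i.e. each entry is `≤ 1`;
* a pairing functional with entries in `[0, 1]` is at most `(2p)!` (`pairingSum_le_factorial_mul_pow`).

This is the template `pinnedZoomLocallyBounded` (`…MoebiusLimitExistsLocallyBounded`) with `K = {y}`, `u m = 1/m`,
and the eventual pair bound from the two-point law replaced by the free bound above.

References: C. M. Newman, Z. Wahrsch. 33 (1975) (Gaussian inequality); M. Aizenman, H. Duminil-Copin,
Ann. Math. 194 (2021), §6.3 first display (lower inequality); A. Messager, S. Miracle-Solé, J. Stat. Phys. 17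
(1977) and H. Duminil-Copin, Lectures on the Ising and Potts models (2019), §4.3 eq. (4.10) (sphere sandwich);
S. Friedli, Y. Velenik (CUP 2017), Thm. 3.20 (GKS). No definitions are introduced.
-/

noncomputable section

namespace Summit.CriticalPhenomena.Ising3DConformalLimit.Cruxes.ExistsScaleCovariantLimit.TwoHierarchies

open Literature.Probability.LatticeModels Filter Set
open scoped Topology
open Summit.CriticalPhenomena.Ising3DConformalLimit.MoebiusLimitExistsOnlyInteraction

/-! ### Exactness of the lattice approximation at integer points along the integer meshes -/

/-- At mesh `1/m` (`m : ℕ`) the lattice approximation of a point of `ℝ³` with integer coordinates `z` is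
EXACT: `[y/(1/m)] = m z` (also for `m = 0`, where both sides vanish). [folklore] -/
theorem latticeApprox_one_div_natCast_of_int {y : EuclideanSpace ℝ (Fin 3)} {z : Site 3}
    (hz : ∀ j, y j = (z j : ℝ)) (m : ℕ) :
    latticeApprox (1 / (m:ℝ)) y = (m : ℤ) • z := by
  funext k
  rw [latticeApprox_apply, hz, Pi.smul_apply, smul_eq_mul, div_div_eq_mul_div, div_one,
    show (z k : ℝ) * (m : ℝ) = (((m : ℤ) * z k : ℤ) : ℝ) by push_cast; ring, Int.floor_intCast]

/-- For `v ≠ 0` in `ℤ^d` and `m : ℕ`, `m ≤ ‖m v‖_∞` (some coordinate of `v` has absolute value `≥ 1`).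
[folklore] -/
theorem le_supNorm_natCast_smul {d : ℕ} {v : Site d} (hv : v ≠ 0) (m : ℕ) :
    m ≤ Site.supNorm ((m : ℤ) • v) := by
  obtain ⟨k, hk⟩ := Function.ne_iff.1 hv
  refine le_trans ?_ (Site.natAbs_le_supNorm _ k)
  rw [Pi.smul_apply, smul_eq_mul, Int.natAbs_mul, Int.natAbs_natCast]
  exact Nat.le_mul_of_pos_right m (Int.natAbs_pos.2 hk)

/-! ### The free pair bound -/

/-- **The free pair bound.** At a pair `x = (x₀, x₁)` of DISTINCT points of `ℝ³` with integer coordinates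
and mesh `1/m`, `m ≥ 1`, the pinned rescaled critical pair correlator is at most `1`: it is the ratio
`⟨σ₀σ_w⟩/⟨σ₀σ_{m e₀}⟩` with `w = m(z₁ − z₀) ∈ ℤ³` (`rescaledCorrelator_rhoPin_two`, exactness of the lattice
approximation), `‖w‖_∞ ≥ m ≥ 1`, and `⟨σ₀σ_w⟩ ≤ ⟨σ₀σ_{‖w‖_∞ e₀}⟩ ≤ ⟨σ₀σ_{m e₀}⟩` by the Messager–Miracle-Solé
sphere bound and axis monotonicity (`criticalTwoPoint_axis_sandwich`, `criticalTwoPoint_axis_antitone`).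
[cite: DuminilCopin2019, Exercise 37 (4), eq. (4.10), §4.3] -/
theorem rescaledCorrelator_two_le_one_of_int {x : Fin 2 → EuclideanSpace ℝ (Fin 3)} (h01 : x 0 ≠ x 1)
    (hint : ∀ i j, ∃ z : ℤ, x i j = (z : ℝ)) {m : ℕ} (hm : 1 ≤ m) :
    rescaledCorrelator (criticalCorr 3) rhoPin 2 (1 / (m:ℝ)) x ≤ 1 := by
  choose z hz using hint
  rw [rescaledCorrelator_rhoPin_two, one_div_one_div, Int.floor_natCast,
    latticeApprox_one_div_natCast_of_int (hz 1), latticeApprox_one_div_natCast_of_int (hz 0), ← smul_sub]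
  have hz01 : (fun j => z 1 j) - (fun j => z 0 j) ≠ (0 : Site 3) := by
    intro h
    apply h01
    refine PiLp.ext fun j => ?_
    have hj := congr_fun h j
    rw [Pi.sub_apply, Pi.zero_apply, sub_eq_zero] at hj
    rw [hz 0 j, hz 1 j, hj]
  have hmw : m ≤ Site.supNorm ((m : ℤ) • ((fun j => z 1 j) - (fun j => z 0 j) : Site 3)) :=
    le_supNorm_natCast_smul hz01 m
  have h1w : 1 ≤ Site.supNorm ((m : ℤ) • ((fun j => z 1 j) - (fun j => z 0 j) : Site 3)) :=
    hm.trans hmw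
  rw [div_le_one (criticalTwoPoint_axis_pos m)]
  exact (criticalTwoPoint_axis_sandwich h1w).2.trans (criticalTwoPoint_axis_antitone hmw)

/-! ### The stub -/

/-- **IB — glue: the pinned zoom is bounded for free at INTEGER configurations along the integer meshes.**
For every `n`, every non-coincident configuration `y` of `ℝ³` with integer coordinates, and all large `m`
(in fact all `m ≥ 1`), `|ρ_pin(1/m)ⁿ ⟨∏ σ_{[yᵢ m]}⟩_{β_c}| ≤ (n)!`. Odd `n`: identically `0`
(`criticalCorr_eq_zero_of_odd`). Even `n = 2p`: `0 ≤ ⟨∏σ⟩ ≤ 𝒢_p[⟨σσ⟩]` (Griffiths I, the tree's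
`criticalCorr_nonneg'`; Newman's Gaussian inequality `criticalCorr_le_pairingSum`), the rescaled pairing
functional is the pairing functional of the pinned pair zooms `ρ_pin²⟨σ_{m zᵢ}σ_{m zⱼ}⟩` (`i ≠ j`;
`PairIsing.pairingSum_eq_pow_mul`), each in `[0, 1]` by the free pair bound
(`rescaledCorrelator_two_le_one_of_int`: MMS sphere sandwich + axis monotonicity, `‖m(zⱼ − zᵢ)‖_∞ ≥ m`), whence
the bound `(2p)! · 1ᵖ` (`pairingSum_le_factorial_mul_pow`). [cite: AizenmanDuminilCopinAnnals2021, arXiv:1912.07973 §6.3, first display, lower inequality (p. 26)] -/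
theorem stub_intConfigBounded :
    ∀ (n : ℕ) (y : Fin n → EuclideanSpace ℝ (Fin 3)), y ∈ NonCoincident 3 n →
      (∀ i j, ∃ z : ℤ, y i j = (z : ℝ)) →
      ∃ M : ℝ, ∀ᶠ m : ℕ in atTop, |rescaledCorrelator (criticalCorr 3) rhoPin n (1 / (m:ℝ)) y| ≤ M := by
  intro n y hy hint
  rcases Nat.even_or_odd n with hn | hn
  swap
  · -- odd orders vanish identically
    refine ⟨0, Eventually.of_forall fun m => ?_⟩
    rw [rescaledCorrelator_apply, criticalCorr_eq_zero_of_odd (d := 3) le_rfl hn, mul_zero, abs_zero]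
  obtain ⟨p, hp⟩ := hn
  rw [← two_mul] at hp
  subst hp
  refine ⟨(2 * p).factorial * (1 : ℝ) ^ p, ?_⟩
  filter_upwards [eventually_ge_atTop 1] with m hm
  -- the free pair bound at every pair of distinct indices
  have hpair : ∀ i j : Fin (2 * p), i ≠ j →
      rescaledCorrelator (criticalCorr 3) rhoPin 2 (1 / (m:ℝ)) ![y i, y j] ≤ 1 := by
    intro i j hij
    refine rescaledCorrelator_two_le_one_of_int (fun h => hij ((mem_nonCoincident y).1 hy h)) ?_ hm
    intro a b
    fin_cases a
    · exact hint i b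
    · exact hint j b
  -- the rescaled pair kernel at the level of indices (diagonal zeroed), as an opaque function
  obtain ⟨T, hT⟩ : ∃ T : Fin (2 * p) → Fin (2 * p) → ℝ, ∀ i j, T i j = if i = j then 0 else
      rhoPin (1 / (m:ℝ)) ^ 2 *
        criticalCorr 3 2 ![latticeApprox (1 / (m:ℝ)) (y i), latticeApprox (1 / (m:ℝ)) (y j)] :=
    ⟨fun i j => if i = j then 0 else rhoPin (1 / (m:ℝ)) ^ 2 *
        criticalCorr 3 2 ![latticeApprox (1 / (m:ℝ)) (y i), latticeApprox (1 / (m:ℝ)) (y j)],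
      fun _ _ => rfl⟩
  have hTeq : ∀ i j, i ≠ j →
      T i j = rescaledCorrelator (criticalCorr 3) rhoPin 2 (1 / (m:ℝ)) ![y i, y j] := by
    intro i j hij
    rw [hT, if_neg hij, rescaledCorrelator_apply, latticeApprox_comp_two]
    rfl
  have hT0 : ∀ i j, 0 ≤ T i j := by
    intro i j
    rw [hT]
    split_ifs
    · exact le_rfl
    · exact mul_nonneg (sq_nonneg _) (criticalCorr_two_nonneg _ _)
  have hT1 : ∀ i j, T i j ≤ 1 := by
    intro i j
    by_cases hij : i = j
    · rw [hT, if_pos hij]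
      exact zero_le_one
    · rw [hTeq i j hij]
      exact hpair i j hij
  -- index-level rescaling identity
  have hP : pairingSum T p id = (rhoPin (1 / (m:ℝ)) ^ 2) ^ p *
      pairingSum (fun a b => criticalCorr 3 2 ![a, b]) p (fun i => latticeApprox (1 / (m:ℝ)) (y i)) :=
    PairIsing.pairingSum_eq_pow_mul (fun a b => criticalCorr 3 2 ![a, b]) T (rhoPin (1 / (m:ℝ)) ^ 2) p
      (fun i => latticeApprox (1 / (m:ℝ)) (y i)) id fun i j hij => by
        simp only [hT, id_eq, if_neg hij]
  have hF : rescaledCorrelator (criticalCorr 3) rhoPin (2 * p) (1 / (m:ℝ)) y =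
      (rhoPin (1 / (m:ℝ)) ^ 2) ^ p * criticalCorr 3 (2 * p) (fun i => latticeApprox (1 / (m:ℝ)) (y i)) := by
    rw [rescaledCorrelator_apply, pow_mul]
  have hρ : 0 ≤ (rhoPin (1 / (m:ℝ)) ^ 2) ^ p := pow_nonneg (sq_nonneg _) p
  have hnn : 0 ≤ criticalCorr 3 (2 * p) (fun i => latticeApprox (1 / (m:ℝ)) (y i)) :=
    Theorems.GapForcesFarMerging.Negative.criticalCorr_nonneg' _
  rw [hF, abs_of_nonneg (mul_nonneg hρ hnn)]
  calc (rhoPin (1 / (m:ℝ)) ^ 2) ^ p * criticalCorr 3 (2 * p) (fun i => latticeApprox (1 / (m:ℝ)) (y i))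
      ≤ (rhoPin (1 / (m:ℝ)) ^ 2) ^ p *
          pairingSum (fun a b => criticalCorr 3 2 ![a, b]) p (fun i => latticeApprox (1 / (m:ℝ)) (y i)) :=
        mul_le_mul_of_nonneg_left (criticalCorr_le_pairingSum p _) hρ
    _ = pairingSum T p id := hP.symm
    _ ≤ (2 * p).factorial * (1 : ℝ) ^ p := pairingSum_le_factorial_mul_pow hT0 hT1 p id

end Summit.CriticalPhenomena.Ising3DConformalLimit.Cruxes.ExistsScaleCovariantLimit.TwoHierarchies

end
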